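import Literature.Probability.RandomPlanarGeometry.HexParafermionProofs
import Literature.Probability.LatticeModels.TriangularLatticeProofs
import HarnessLib

/-!
# Lattice-symmetry transport of the DCS observable, part A: graph automorphisms acting by
similarities (line `liouville-local-limits` of the crux `InteriorFlattening`,
stmt-CriticalPhenomena-8297; helper for the stubs `stub_compactnessAtOrigin` (S2) and
`stub_uniquenessReduction` (S7), lead c1)

A graph automorphism `T : hexGraph ≃g hexGraph` of the honeycomb lattice transports every object
of the line: vertex sets (`Λ.image T`), mid-edges (`Sym2.map T`), the domain / boundary mid-edges
(`map_mem_hexDomainMidEdges_iff`, `map_mem_hexDomainBoundary_iff`), simple connectivity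
("connected complement", `hexDomainSimplyConnected_image_iff`) and the self-avoiding walks between
mid-edges (`exists_walk_map`: the walk with vertex list `T ∘ γ`) with their lengths. If moreover `T`
acts on the embedded face centres by a complex-affine map, `hexCenter (T f) = α * hexCenter f + β`
(`α ≠ 0`), then mid-edges move by the same map (`hexMidpoint_map`), so does the whole polyline of
a walk (`points_eq_of_verts_eq`), whence windings (`winding_map_affine`) and weights are preserved
and **the parafermionic observable is invariant**: `F_{T Λ}(T a, T z; x, σ) = F_Λ(a, z; x, σ)`
(`hexParafermionicObservable_image`; inverse form `hexParafermionicObservable_image_symm`;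
registered binder-free form `transport_hexParafermionicObservable`). For `‖α‖ = 1` distances of
centres, hence Euclidean balls of lattice vertices (the Defs' `Deep`, spelled out), are
transported too (`dist_hexCenter_map`, `ball_subset_image_iff`). Part B
(`…LiouvilleTransport.lean`) supplies the generators: translations, the central flip, the
rotation by `120°` about the centre of the origin vertex.

Sources: H. Duminil-Copin, S. Smirnov, Ann. of Math. 175 (2012) 1653–1665 (arXiv:1007.0575),
§1–2 (walks between mid-edges, the winding as total rotation of the direction, Definition 1). The
walk transport is adapted from `…Theorems.SAWDefectDecoherenceDefectDecoherenceTmAdmissible`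
(`mapW`), the image lemmas from `…Theorems.HexObservableLimitR.Negative.Mirror`. No object of the
line's Defs module occurs here (pure lattice/observable facts); no definition is introduced.
-/

noncomputable section

open scoped BigOperators
open Literature.Probability.LatticeModels Literature.Probability.RandomPlanarGeometry.SAW

namespace Summit.CriticalPhenomena.SAWScalingLimit.Theorems.InteriorFlattening.Liouville.Transport

variable (T : hexGraph ≃g hexGraph)

/-! ### Images of vertex sets and mid-edges under a graph automorphism -/

/-- Membership in the image vertex set, through the inverse (`T v ∈ Λ.image T ↔ v ∈ Λ` is
Mathlib's `T.injective.mem_finset_image`). [folklore] -/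
theorem mem_image_iff {Λ : Finset HexVertex} {w : HexVertex} :
    w ∈ Λ.image T ↔ T.symm w ∈ Λ := by
  rw [Finset.mem_image]
  constructor
  · rintro ⟨v, hv, rfl⟩
    rwa [RelIso.symm_apply_apply]
  · intro h
    exact ⟨T.symm w, h, RelIso.apply_symm_apply T w⟩

/-- The inverse image of the image is the set. [folklore] -/
@[simp] theorem image_symm_image (Λ : Finset HexVertex) : (Λ.image T).image T.symm = Λ := by
  ext v
  rw [Finset.mem_image]
  constructor
  · rintro ⟨w, hw, rfl⟩
    exact (mem_image_iff T).1 hw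
  · intro hv
    exact ⟨T v, T.injective.mem_finset_image.2 hv, RelIso.symm_apply_apply T v⟩

/-- The image of the inverse image is the set. [folklore] -/
@[simp] theorem image_image_symm (Λ : Finset HexVertex) : (Λ.image T.symm).image T = Λ := by
  ext v
  rw [Finset.mem_image]
  constructor
  · rintro ⟨w, hw, rfl⟩
    obtain ⟨u, hu, rfl⟩ := Finset.mem_image.1 hw
    rwa [RelIso.apply_symm_apply]
  · intro hv
    exact ⟨T.symm v, Finset.mem_image_of_mem _ hv, RelIso.apply_symm_apply T v⟩

/-- `Sym2.map T.symm` inverts `Sym2.map T`. [folklore] -/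
@[simp] theorem map_symm_map (e : Sym2 HexVertex) : (e.map T).map T.symm = e := by
  induction e using Sym2.ind with
  | _ p q => rw [Sym2.map_mk, Sym2.map_mk, RelIso.symm_apply_apply, RelIso.symm_apply_apply]

/-- `Sym2.map T` inverts `Sym2.map T.symm`. [folklore] -/
@[simp] theorem map_map_symm (e : Sym2 HexVertex) : (e.map T.symm).map T = e := by
  induction e using Sym2.ind with
  | _ p q => rw [Sym2.map_mk, Sym2.map_mk, RelIso.apply_symm_apply, RelIso.apply_symm_apply]

/-- The complement of the image vertex set is the image of the complement. [folklore] -/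
theorem compl_coe_image (Λ : Finset HexVertex) :
    ((Λ.image T : Finset HexVertex) : Set HexVertex)ᶜ = T '' ((Λ : Set HexVertex)ᶜ) := by
  rw [Finset.coe_image, Set.image_compl_eq T.bijective]

/-- **Domain mid-edges are transported.** [folklore] -/
theorem map_mem_hexDomainMidEdges_iff (Λ : Finset HexVertex) (e : Sym2 HexVertex) :
    e.map T ∈ hexDomainMidEdges (Λ.image T) ↔ e ∈ hexDomainMidEdges Λ := by
  constructor
  · rintro ⟨he, w, hw, hwΛ⟩
    obtain ⟨v, hv, rfl⟩ := Sym2.mem_map.1 hw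
    exact ⟨T.map_mem_edgeSet_iff.1 he, v, hv, T.injective.mem_finset_image.1 hwΛ⟩
  · rintro ⟨he, v, hv, hvΛ⟩
    exact ⟨T.map_mem_edgeSet_iff.2 he, T v, Sym2.mem_map.2 ⟨v, hv, rfl⟩,
      T.injective.mem_finset_image.2 hvΛ⟩

/-- **Boundary mid-edges are transported.** [folklore] -/
theorem map_mem_hexDomainBoundary_iff (Λ : Finset HexVertex) (e : Sym2 HexVertex) :
    e.map T ∈ hexDomainBoundary (Λ.image T) ↔ e ∈ hexDomainBoundary Λ := by
  constructor
  · rintro ⟨he, u, v, huv, hv, hu⟩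
    refine ⟨T.map_mem_edgeSet_iff.1 he, T.symm u, T.symm v, ?_, (mem_image_iff T).1 hv,
      fun h => hu ((mem_image_iff T).2 h)⟩
    have := congrArg (Sym2.map T.symm) huv
    rwa [map_symm_map, Sym2.map_mk] at this
  · rintro ⟨he, u, v, rfl, hv, hu⟩
    exact ⟨T.map_mem_edgeSet_iff.2 he, T u, T v, by rw [Sym2.map_mk],
      T.injective.mem_finset_image.2 hv, fun h => hu (T.injective.mem_finset_image.1 h)⟩

/-! ### Simple connectivity is transported -/

/-- Connectivity of induced subgraphs is transported along a graph automorphism. [folklore] -/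
theorem preconnected_induce_image_iff (S : Set HexVertex) :
    (hexGraph.induce (T '' S)).Preconnected ↔ (hexGraph.induce S).Preconnected := by
  have key : ∀ (R : hexGraph ≃g hexGraph) (S : Set HexVertex), (hexGraph.induce S).Preconnected →
      (hexGraph.induce (R '' S)).Preconnected := fun R S h => by
    refine h.map (SimpleGraph.induceHom R.toHom (Set.mapsTo_image R S)) ?_
    rintro ⟨w, v, hv, rfl⟩
    exact ⟨⟨v, hv⟩, rfl⟩
  refine ⟨fun h => ?_, key T S⟩
  have h' := key T.symm _ h
  rwa [← Set.image_comp, show (⇑T.symm ∘ ⇑T) = id from funext (RelIso.symm_apply_apply T),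
    Set.image_id] at h'

/-- **Simple connectivity ("connected complement") is transported.** [folklore] -/
theorem hexDomainSimplyConnected_image_iff (Λ : Finset HexVertex) :
    hexDomainSimplyConnected (Λ.image T) ↔ hexDomainSimplyConnected Λ := by
  unfold hexDomainSimplyConnected
  rw [compl_coe_image, preconnected_induce_image_iff]

/-! ### Automorphisms acting affinely on the embedded lattice -/

/-- Mid-edges move by the same affine map as the centres. [folklore] -/
theorem hexMidpoint_map {α β : ℂ} (hT : ∀ f, hexCenter (T f) = α * hexCenter f + β)
    (e : Sym2 HexVertex) : hexMidpoint (e.map T) = α * hexMidpoint e + β := by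
  induction e using Sym2.ind with
  | _ p q => simp only [Sym2.map_mk, hexMidpoint_mk, hT]; ring

/-- The affine data of a composite. [folklore] -/
theorem affine_trans {T₁ T₂ : hexGraph ≃g hexGraph} {α₁ β₁ α₂ β₂ : ℂ}
    (h₁ : ∀ f, hexCenter (T₁ f) = α₁ * hexCenter f + β₁)
    (h₂ : ∀ f, hexCenter (T₂ f) = α₂ * hexCenter f + β₂) (f : HexVertex) :
    hexCenter ((T₁.trans T₂) f) = (α₂ * α₁) * hexCenter f + (α₂ * β₁ + β₂) := by
  rw [RelIso.trans_apply]
  erw [h₂, h₁]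
  ring

/-- The affine data of the inverse. [folklore] -/
theorem affine_symm {α β : ℂ} (hα : α ≠ 0)
    (hT : ∀ f, hexCenter (T f) = α * hexCenter f + β) (f : HexVertex) :
    hexCenter (T.symm f) = α⁻¹ * hexCenter f + (-(α⁻¹ * β)) := by
  have h := hT (T.symm f)
  rw [RelIso.apply_symm_apply] at h
  rw [h]
  field_simp
  ring

/-- An automorphism acting by an affine ISOMETRY preserves distances of centres. [folklore] -/
theorem dist_hexCenter_map {α β : ℂ} (h1 : ‖α‖ = 1)
    (hT : ∀ f, hexCenter (T f) = α * hexCenter f + β) (v w : HexVertex) :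
    dist (hexCenter (T v)) (hexCenter (T w)) = dist (hexCenter v) (hexCenter w) := by
  rw [Complex.dist_eq, Complex.dist_eq, hT, hT,
    show α * hexCenter v + β - (α * hexCenter w + β) = α * (hexCenter v - hexCenter w) by ring,
    norm_mul, h1, one_mul]

/-- **Euclidean balls of lattice vertices are transported** (the Defs' `Deep Λ v R`, spelled
out): the `R`-ball around `T v` lies in `T Λ` iff the `R`-ball around `v` lies in `Λ`.
[folklore] -/
theorem ball_subset_image_iff {α β : ℂ} (h1 : ‖α‖ = 1)
    (hT : ∀ f, hexCenter (T f) = α * hexCenter f + β) (Λ : Finset HexVertex) (v : HexVertex)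
    (R : ℝ) :
    (∀ w : HexVertex, dist (hexCenter w) (hexCenter (T v)) ≤ R → w ∈ Λ.image T) ↔
      (∀ w : HexVertex, dist (hexCenter w) (hexCenter v) ≤ R → w ∈ Λ) := by
  constructor
  · intro h w hw
    refine T.injective.mem_finset_image.1 (h (T w) ?_)
    rwa [dist_hexCenter_map T h1 hT]
  · intro h w hw
    refine (mem_image_iff T).2 (h (T.symm w) ?_)
    rw [← dist_hexCenter_map T h1 hT, RelIso.apply_symm_apply]
    exact hw

/-! ### Transport of self-avoiding walks between mid-edges -/

section Walks

variable {Λ Λ' : Finset HexVertex} {a z : Sym2 HexVertex}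

/-- **Transport of a walk along a graph automorphism** `S` of `ℍ` (adapted from
`…TmAdmissible.mapW`): if `S` maps `Λ₁` into `Λ₂`, every walk of `Λ₁` from `a₁` to `z₁` has a
companion walk of `Λ₂` from `S a₁` to `S z₁` with vertex list `S ∘ γ`. [folklore] -/
theorem exists_walk_map (S : hexGraph ≃g hexGraph) {Λ₁ Λ₂ : Finset HexVertex}
    {a₁ z₁ a₂ z₂ : Sym2 HexVertex} (hΛ : ∀ v ∈ Λ₁, S v ∈ Λ₂) (ha : a₂ = a₁.map S)
    (hz : z₂ = z₁.map S) (γ : HexMidEdgeSAW Λ₁ a₁ z₁) :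
    ∃ γ' : HexMidEdgeSAW Λ₂ a₂ z₂, γ'.verts = γ.verts.map S := by
  subst ha hz
  refine ⟨{ verts := γ.verts.map S
            subset := fun x hx => ?_
            nodup := γ.nodup.map S.injective
            isChain := List.isChain_map_of_isChain S (fun _ _ h => S.map_rel_iff.2 h) γ.isChain
            head_mem := fun x hx => ?_
            getLast_mem := fun x hx => ?_
            eq_of_nil := fun h => by rw [γ.eq_of_nil (List.map_eq_nil_iff.1 h)]
            edges_nodup := fun h => ?_
            fst_mem := ?_ }, rfl⟩
  · obtain ⟨y, hy, rfl⟩ := List.mem_map.1 hx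
    exact hΛ y (γ.subset y hy)
  · rw [List.head?_map, Option.map_eq_some_iff] at hx
    obtain ⟨y, hy, rfl⟩ := hx
    exact Sym2.mem_map.2 ⟨y, γ.head_mem y hy, rfl⟩
  · rw [List.getLast?_map, Option.map_eq_some_iff] at hx
    obtain ⟨y, hy, rfl⟩ := hx
    exact Sym2.mem_map.2 ⟨y, γ.getLast_mem y hy, rfl⟩
  · have hne : γ.verts ≠ [] := fun e => h (by rw [e]; rfl)
    have key : a₁.map S ::
        List.zipWith (fun u w => s(u, w)) (γ.verts.map S) (γ.verts.map S).tail ++ [z₁.map S] =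
        (a₁ :: List.zipWith (fun u w => s(u, w)) γ.verts γ.verts.tail ++ [z₁]).map
          (Sym2.map S) := by
      rw [← List.map_tail]
      simp only [List.map_cons, List.map_append, List.map_nil, List.zipWith_map_left,
        List.zipWith_map_right, List.map_zipWith, Sym2.map_mk]
    rw [key]
    exact (γ.edges_nodup hne).map (Sym2.map.injective S.injective)
  · obtain ⟨he, y, hy, hyΛ⟩ := γ.fst_mem
    exact ⟨S.map_mem_edgeSet_iff.2 he, S y, Sym2.mem_map.2 ⟨y, hy, rfl⟩, hΛ y hyΛ⟩

/-- A companion walk has the same length. [folklore] -/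
theorem length_eq_of_verts_eq {a' z' : Sym2 HexVertex} (γ : HexMidEdgeSAW Λ a z)
    (γ' : HexMidEdgeSAW Λ' a' z') (h : γ'.verts = γ.verts.map T) : γ'.length = γ.length := by
  rw [HexMidEdgeSAW.length, HexMidEdgeSAW.length, h, List.length_map]

/-- The polyline of a companion walk is the affine image of the polyline. [folklore] -/
theorem points_eq_of_verts_eq {α β : ℂ} (hT : ∀ f, hexCenter (T f) = α * hexCenter f + β)
    (γ : HexMidEdgeSAW Λ a z) (γ' : HexMidEdgeSAW Λ' (a.map T) (z.map T))
    (h : γ'.verts = γ.verts.map T) : γ'.points = γ.points.map fun w => α * w + β := by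
  simp [HexMidEdgeSAW.points, h, hexMidpoint_map T hT, List.map_map, Function.comp_def, hT]

/-- **A companion walk has the same winding** (every point of the polyline moves by the same
complex-affine map, `winding_map_affine`). [folklore] -/
theorem winding_eq_of_verts_eq {α β : ℂ} (hα : α ≠ 0)
    (hT : ∀ f, hexCenter (T f) = α * hexCenter f + β) (γ : HexMidEdgeSAW Λ a z)
    (γ' : HexMidEdgeSAW Λ' (a.map T) (z.map T)) (h : γ'.verts = γ.verts.map T) :
    γ'.winding = γ.winding := by
  unfold HexMidEdgeSAW.winding
  rw [points_eq_of_verts_eq T hT γ γ' h, winding_map_affine hα]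

/-- A companion walk has the same weight. [folklore] -/
theorem weight_eq_of_verts_eq {α β : ℂ} (hα : α ≠ 0)
    (hT : ∀ f, hexCenter (T f) = α * hexCenter f + β) (γ : HexMidEdgeSAW Λ a z)
    (γ' : HexMidEdgeSAW Λ' (a.map T) (z.map T)) (h : γ'.verts = γ.verts.map T) (x σ : ℝ) :
    γ'.weight x σ = γ.weight x σ := by
  rw [HexMidEdgeSAW.weight, HexMidEdgeSAW.weight, winding_eq_of_verts_eq T hα hT γ γ' h,
    length_eq_of_verts_eq T γ γ' h]

end Walks

/-! ### Invariance of the observable -/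

/-- **The parafermionic observable is invariant under lattice symmetries acting by
similarities**: `F_{T Λ}(T a, T z; x, σ) = F_Λ(a, z; x, σ)` (the companion walks form a
bijection — the inverse automorphism gives the inverse map — with equal weights). [folklore] -/
theorem hexParafermionicObservable_image {α β : ℂ} (hα : α ≠ 0)
    (hT : ∀ f, hexCenter (T f) = α * hexCenter f + β) (Λ : Finset HexVertex)
    (a z : Sym2 HexVertex) (x σ : ℝ) :
    hexParafermionicObservable (Λ.image T) (a.map T) x σ (z.map T) =
      hexParafermionicObservable Λ a x σ z := by
  classical
  choose f hf using fun γ : HexMidEdgeSAW Λ a z =>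
    exists_walk_map T (Λ₂ := Λ.image T) (fun v hv => Finset.mem_image_of_mem _ hv) rfl rfl γ
  choose g hg using fun γ' : HexMidEdgeSAW (Λ.image T) (a.map T) (z.map T) =>
    exists_walk_map T.symm (Λ₂ := Λ) (fun v hv => (mem_image_iff T).1 hv)
      (map_symm_map T a).symm (map_symm_map T z).symm γ'
  have hgf : ∀ γ, g (f γ) = γ := fun γ => HexMidEdgeSAW.ext <| by
    rw [hg, hf, List.map_map]
    conv_rhs => rw [← List.map_id γ.verts]
    exact List.map_congr_left fun v _ => RelIso.symm_apply_apply T v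
  have hfg : ∀ γ', f (g γ') = γ' := fun γ' => HexMidEdgeSAW.ext <| by
    rw [hf, hg, List.map_map]
    conv_rhs => rw [← List.map_id γ'.verts]
    exact List.map_congr_left fun v _ => RelIso.apply_symm_apply T v
  let e : HexMidEdgeSAW Λ a z ≃ HexMidEdgeSAW (Λ.image T) (a.map T) (z.map T) :=
    ⟨f, g, hgf, hfg⟩
  rw [hexParafermionicObservable_def, hexParafermionicObservable_def]
  exact (Fintype.sum_equiv e _ _ fun γ =>
    (weight_eq_of_verts_eq T hα hT γ (f γ) (hf γ) x σ).symm).symm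

/-- The observable of the inverse-image configuration is the observable at the image mid-edge:
`F_{T⁻¹ Λ}(T⁻¹ a, z) = F_Λ(a, T z)`. [folklore] -/
theorem hexParafermionicObservable_image_symm {α β : ℂ} (hα : α ≠ 0)
    (hT : ∀ f, hexCenter (T f) = α * hexCenter f + β) (Λ : Finset HexVertex)
    (a z : Sym2 HexVertex) (x σ : ℝ) :
    hexParafermionicObservable (Λ.image T.symm) (a.map T.symm) x σ z =
      hexParafermionicObservable Λ a x σ (z.map T) := by
  have h := hexParafermionicObservable_image T hα hT (Λ.image T.symm) (a.map T.symm) z x σ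
  rw [image_image_symm, map_map_symm] at h
  exact h.symm

/-- The observable at the image of a vertex pair. [folklore] -/
theorem hexParafermionicObservable_image_mk {α β : ℂ} (hα : α ≠ 0)
    (hT : ∀ f, hexCenter (T f) = α * hexCenter f + β) (Λ : Finset HexVertex)
    (a : Sym2 HexVertex) (v w : HexVertex) (x σ : ℝ) :
    hexParafermionicObservable (Λ.image T) (a.map T) x σ s(T v, T w) =
      hexParafermionicObservable Λ a x σ s(v, w) := by
  rw [← hexParafermionicObservable_image T hα hT Λ a s(v, w) x σ, Sym2.map_mk]

/-- **Registered form** (the sub-goal of the crux this file carries): the parafermionic observable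
is invariant under every graph automorphism of `ℍ` acting on the face centres by a similarity
`z ↦ α z + β`, `α ≠ 0`. [folklore] -/
theorem transport_hexParafermionicObservable :
    ∀ (T : hexGraph ≃g hexGraph) (α β : ℂ), α ≠ 0 →
      (∀ f : HexVertex, hexCenter (T f) = α * hexCenter f + β) →
        ∀ (Λ : Finset HexVertex) (a z : Sym2 HexVertex) (x σ : ℝ),
          hexParafermionicObservable (Λ.image T) (a.map T) x σ (z.map T) =
            hexParafermionicObservable Λ a x σ z :=
  fun T _ _ hα hT Λ a z x σ => hexParafermionicObservable_image T hα hT Λ a z x σ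

end Summit.CriticalPhenomena.SAWScalingLimit.Theorems.InteriorFlattening.Liouville.Transport

end
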